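import Literature.Computability.QuantumComplexity.RandomOracleIndependence
import Literature.Computability.Complexity.AlmostPProofs
import Literature.Computability.Complexity.BPPSubsetAlmostP
import Literature.Computability.Complexity.OracleCompositionMachine
import Mathlib.Probability.Independence.ZeroOne
import HarnessLib

/-!
# The zero-one law for random-oracle events, and the event `L ∈ P^A`

Topic `Literature/Computability/QuantumComplexity` (random-oracle toolkit, continuing
`RandomOracleIndependence.lean` and `Complexity/AlmostPProofs.lean`).

Reproduced here (statements and proofs are the classical ones; nothing is claimed as new):

* **Kolmogorov's zero-one law in Bennett–Gill's form** (`measure_zero_or_one_of_sdiff_invariant`):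
  an event `E ⊆ 2^{{0,1}*}` of oracles that is measurable and invariant under finite variations of
  the oracle — here in the convenient one-sided form "`A ∈ E ↔ A ∖ U ∈ E` for every finite set of
  strings `U`" — has probability `0` or `1` under the fair-coin random-oracle measure
  `randomOracleMeasure`. C. H. Bennett, J. Gill, *Relative to a random oracle `A`,
  `P^A ≠ NP^A ≠ co-NP^A` with probability 1*, SIAM J. Comput. 10 (1981) 96–113, Lemma 1
  ("zero-one law"; cited from memory of the numbering, the paper is not held — acq-00719); the
  form used in the random-oracle literature is "a measurable tail set must have measure 0 or 1",
  S. A. Kurtz, S. R. Mahaney, J. S. Royer, *The isomorphism conjecture fails relative to a random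
  oracle*, STOC 1989, §4.1 (p. 18 of the held copy, citing Oxtoby 1980, Thm. 21.3). PROOF (the
  textbook one, via Mathlib's `ProbabilityTheory.measure_eq_zero_or_one_of_indepSet_self`): by
  invariance `E` is measurable in the coordinates off every finite window `U`
  (`measurable_strSigma_sdiff`), hence independent of the window σ-algebra `strSigma U`
  (`indep_strSigma`); the window σ-algebras are directed and generate the product σ-algebra
  (`measurableSet_iSup_strSigma`), so `E` is independent of itself
  (`ProbabilityTheory.indep_iSup_of_directed_le`).
* **The event `{A | L ∈ P^A}` is measurable and invariant under finite variations**
  (`measurableSet_setOf_mem_PRel`, `sdiff_finset_mem_setOf_mem_PRel_iff`): it is the countable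
  union over (capped) polynomial-time oracle machines and polynomial budgets of the "good sets" of
  `AlmostPProofs.lean` (`setOf_mem_PRel_eq_iUnion`), and `P^B ⊆ P^A` whenever `B` and `A` agree
  on all long strings (`PRel_ofLanguage_subset_of_eqOn_le`: `B ∈ P^A` by finite patching,
  `mem_PRel_of_eqOn_le`, and polynomial-time oracle machines compose,
  `OracleAlg.PRel_subset_PRel_of_mem_FPRel`). Bennett–Gill 1981, §1 ("class membership is
  unaffected by finite changes of the oracle"); R. V. Book, H. Vollmer, K. W. Wagner, ICALP 1996,
  §4 Thm. 3 (uniform invariance under finite variations).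
* Hence **`μ{A | L ∈ P^A} ∈ {0, 1}`** for every language `L` (`measure_setOf_mem_PRel_zero_or_one`)
  and the dichotomy `ae_mem_PRel_or_ae_not_mem`: every fixed language is in `P^A` for almost every
  oracle or outside `P^A` for almost every oracle — the step that turns Fortnow–Rogers' "if
  `P^A = BQP^A` with probability 1 then `BQP = BPP`" (JCSS 59 (1999), Thm. 4.4) into "if
  `BQP ≠ BPP` then `P^A ≠ BQP^A` with probability 1".

## References

* C. H. Bennett, J. Gill, SIAM J. Comput. 10 (1981) 96–113, §1 and Lemma 1. [BennettGill1981]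
* S. A. Kurtz, S. R. Mahaney, J. S. Royer, *The isomorphism conjecture fails relative to a random
  oracle*, STOC 1989, §4.1. [doi:10.1145/73007.73022]
* J. C. Oxtoby, *Measure and Category*, 2nd ed., Springer GTM 2 (1980), Thm. 21.3.
* R. V. Book, H. Vollmer, K. W. Wagner, *On type-2 probabilistic quantifiers*, ICALP 1996, §4
  Thm. 3. [BookVollmerWagner1996]
* L. Fortnow, J. Rogers, *Complexity limitations on quantum computation*, J. Comput. System Sci.
  59 (1999) 240–252, Thm. 4.4. [FortnowRogers1999]
-/

namespace Literature.Computability.QuantumComplexity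

open MeasureTheory ProbabilityTheory MeasurableSpace Literature.Computability.Complexity
  _root_.Computability

/-! ### The window σ-algebras generate the product σ-algebra -/

/-- Coordinate σ-algebras are monotone in the set of coordinates. [folklore] -/
theorem strSigma_mono {S T : Set (List Bool)} (h : S ⊆ T) : strSigma S ≤ strSigma T :=
  generateFrom_mono (by rintro E ⟨s, hs, rfl⟩; exact ⟨s, h hs, rfl⟩)

/-- The window σ-algebras `strSigma U`, `U` finite, are directed. [folklore] -/
theorem directed_strSigma_finset :
    Directed (· ≤ ·) fun U : Finset (List Bool) => strSigma (↑U : Set (List Bool)) := by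
  classical
  intro U V
  refine ⟨U ∪ V, strSigma_mono ?_, strSigma_mono ?_⟩
  · rw [Finset.coe_union]; exact Set.subset_union_left
  · rw [Finset.coe_union]; exact Set.subset_union_right

/-- **The finite-window σ-algebras generate the product σ-algebra**: every measurable set of
oracles is measurable with respect to `⨆_U strSigma U` over finite `U` (each coordinate event
`{A | z ∈ A}` lies in the window `{z}`). [folklore] -/
theorem measurableSet_iSup_strSigma {E : Set (Set (List Bool))} (hE : MeasurableSet E) :
    MeasurableSet[⨆ U : Finset (List Bool), strSigma (↑U : Set (List Bool))] E := by
  have hid : @Measurable (Set (List Bool)) (Set (List Bool))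
      (⨆ U : Finset (List Bool), strSigma (↑U : Set (List Bool))) inferInstance id := by
    refine (@measurable_set_iff (List Bool) (Set (List Bool))
      (⨆ U : Finset (List Bool), strSigma (↑U : Set (List Bool))) id).2 fun z => ?_
    refine (@measurableSet_setOf (Set (List Bool))
      (⨆ U : Finset (List Bool), strSigma (↑U : Set (List Bool))) fun A => z ∈ id A).1 ?_
    have hz : MeasurableSet[strSigma (↑({z} : Finset (List Bool)) : Set (List Bool))]
        (strEvent z) :=
      measurableSet_strSigma_strEvent (by simp)
    exact (le_iSup (fun U : Finset (List Bool) => strSigma (↑U : Set (List Bool))) {z}) _ hz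
  exact hid hE

/-! ### Kolmogorov's zero-one law for finitely invariant oracle events -/

/-- **Zero-one law (Bennett–Gill 1981, Lemma 1; Kolmogorov).** A measurable event of oracles that
is invariant under clearing any finite window (`A ∈ E ↔ A ∖ U ∈ E` for every finite `U`) has
random-oracle probability `0` or `1`. [cite: BennettGill1981, Lemma 1 (zero-one law)] -/
theorem measure_zero_or_one_of_sdiff_invariant {E : Set (Set (List Bool))} (hE : MeasurableSet E)
    (hinv : ∀ (U : Finset (List Bool)) (A : Set (List Bool)), A \ ↑U ∈ E ↔ A ∈ E) :
    randomOracleMeasure E = 0 ∨ randomOracleMeasure E = 1 := by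
  -- `E` is measurable in the coordinates off any finite window
  have hEU : ∀ U : Finset (List Bool), MeasurableSet[strSigma (↑U : Set (List Bool))ᶜ] E := by
    intro U
    have hpre : E = (fun A : Set (List Bool) => A \ ↑U) ⁻¹' E :=
      Set.ext fun A => (hinv U A).symm
    rw [hpre]
    exact measurable_strSigma_sdiff U hE
  -- so every window σ-algebra is independent of `σ(E)`
  have hgen_le : ∀ U : Finset (List Bool),
      generateFrom {E} ≤ strSigma (↑U : Set (List Bool))ᶜ := fun U =>
    generateFrom_le fun t ht => by rw [Set.mem_singleton_iff.1 ht]; exact hEU U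
  have hind : ∀ U : Finset (List Bool),
      Indep (strSigma (↑U : Set (List Bool))) (generateFrom {E}) randomOracleMeasure := fun U =>
    indep_of_indep_of_le_right (indep_strSigma disjoint_compl_right) (hgen_le U)
  have hgen_le' : generateFrom {E} ≤ (inferInstance : MeasurableSpace (Set (List Bool))) :=
    generateFrom_le fun t ht => by rw [Set.mem_singleton_iff.1 ht]; exact hE
  -- the windows are directed and generate everything: `E` is independent of itself
  have hsup : Indep (⨆ U : Finset (List Bool), strSigma (↑U : Set (List Bool)))
      (generateFrom {E}) randomOracleMeasure :=
    indep_iSup_of_directed_le hind (fun U => strSigma_le _) hgen_le' directed_strSigma_finset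
  exact measure_eq_zero_or_one_of_indepSet_self
    (hsup.indepSet_of_measurableSet (measurableSet_iSup_strSigma hE)
      (measurableSet_generateFrom (Set.mem_singleton E)))

/-! ### The event `L ∈ P^A` -/

/-- **Finite variations of the oracle do not change `P^A`** (one inclusion; the other by
symmetry): if `B` and `A` agree on all strings of length `≥ n₀` then `P^B ⊆ P^A` — `B ∈ P^A`
(hard-wire the short strings, `mem_PRel_of_eqOn_le` with `A ∈ P^A`), so the language oracle of
`B` is in `FP^A` and polynomial-time oracle machines compose.
[cite: BennettGill1981, §1] [cite: BookVollmerWagner1996, §4 Thm. 3 (p. 374)] -/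
theorem PRel_ofLanguage_subset_of_eqOn_le {A B : Set (List Bool)} (n₀ : ℕ)
    (h : ∀ x : List Bool, n₀ ≤ x.length → (x ∈ B ↔ x ∈ A)) :
    PRel (Oracle.ofLanguage B) ⊆ PRel (Oracle.ofLanguage A) :=
  OracleAlg.PRel_subset_PRel_of_mem_FPRel
    (OracleAlg.ofLanguage_mem_FPRel_of_mem_PRel
      (mem_PRel_of_eqOn_le (self_mem_PRel_ofLanguage_holds A) n₀ h))

/-- Clearing a finite window of the oracle does not change whether `L ∈ P^A`. [cite: BennettGill1981, §1] -/
theorem sdiff_finset_mem_setOf_mem_PRel_iff (L : Language Bool) (U : Finset (List Bool))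
    (A : Set (List Bool)) :
    A \ (↑U : Set (List Bool)) ∈ {A : Set (List Bool) | L ∈ PRel (Oracle.ofLanguage A)} ↔
      A ∈ {A : Set (List Bool) | L ∈ PRel (Oracle.ofLanguage A)} := by
  obtain ⟨n₀, hn₀⟩ : ∃ n₀ : ℕ, ∀ x : List Bool, n₀ ≤ x.length → x ∉ U :=
    ⟨U.sup List.length + 1, fun x hx hxU => by
      have := Finset.le_sup (f := List.length) hxU
      omega⟩
  have h1 : ∀ x : List Bool, n₀ ≤ x.length → (x ∈ A \ (↑U : Set (List Bool)) ↔ x ∈ A) :=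
    fun x hx => by simp [hn₀ x hx]
  simp only [Set.mem_setOf_eq]
  constructor
  · exact fun hL => PRel_ofLanguage_subset_of_eqOn_le n₀ h1 hL
  · exact fun hL => PRel_ofLanguage_subset_of_eqOn_le n₀ (fun x hx => (h1 x hx).symm) hL

/-- **`{A | L ∈ P^A}` as a countable union of good sets**: over polynomial-time machines `M` and
budgets `q`, the good sets of the capped machines `M.capQ q false` (queries longer than the
budget answered `false` without asking, so that the query-length clause of `P^A` holds by
construction). [folklore] -/
theorem setOf_mem_PRel_eq_iUnion (L : Language Bool) :
    {A : Set (List Bool) | L ∈ PRel (Oracle.ofLanguage A)} =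
      ⋃ i : {M : OracleAlg Bool // M.IsPolyTime encodingBoolBool} × Polynomial ℕ,
        goodSet L (i.1.1.capQ i.2 false) i.2 := by
  apply Set.Subset.antisymm
  · intro A hA
    obtain ⟨i, hi⟩ := Set.mem_iUnion.1 (setOf_mem_PRel_subset_iUnion L hA)
    exact Set.mem_iUnion.2 ⟨i, decidesRel_subset_goodSet L _ _ hi⟩
  · intro A hA
    obtain ⟨⟨⟨M, hM⟩, q⟩, hA⟩ := Set.mem_iUnion.1 hA
    refine mem_PRel_iff.2 ⟨M.capQ q false, OracleAlg.isPolyTime_capQ encodingBoolBool hM q false, q,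
      fun x => ⟨?_, ?_⟩⟩
    · rw [OracleAlg.run_ofLanguage_eq_runWith]
      exact hA x
    · exact fun y hy => OracleAlg.length_le_of_mem_queries_capQ M q false _ x _ hy

/-- **The event `{A | L ∈ P^A}` is measurable.** [folklore] -/
theorem measurableSet_setOf_mem_PRel (L : Language Bool) :
    MeasurableSet {A : Set (List Bool) | L ∈ PRel (Oracle.ofLanguage A)} := by
  haveI : Countable (Polynomial ℕ) := countable_polynomial_nat
  haveI : Countable {M : OracleAlg Bool // M.IsPolyTime encodingBoolBool} :=
    (countable_setOf_isPolyTime encodingBoolBool).to_subtype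
  rw [setOf_mem_PRel_eq_iUnion]
  exact MeasurableSet.iUnion fun i => measurableSet_goodSet L _ _

/-- **`μ{A | L ∈ P^A} ∈ {0, 1}` for every language `L`.** [cite: BennettGill1981, Lemma 1 (zero-one law)] -/
theorem measure_setOf_mem_PRel_zero_or_one (L : Language Bool) :
    randomOracleMeasure {A : Set (List Bool) | L ∈ PRel (Oracle.ofLanguage A)} = 0 ∨
      randomOracleMeasure {A : Set (List Bool) | L ∈ PRel (Oracle.ofLanguage A)} = 1 :=
  measure_zero_or_one_of_sdiff_invariant (measurableSet_setOf_mem_PRel L)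
    (sdiff_finset_mem_setOf_mem_PRel_iff L)

/-- **Dichotomy**: a fixed language is in `P^A` for almost every oracle `A`, or outside `P^A` for
almost every oracle `A`. [cite: BennettGill1981, Lemma 1 (zero-one law)] -/
theorem ae_mem_PRel_or_ae_not_mem (L : Language Bool) :
    (∀ᵐ (A : Set (List Bool)) ∂randomOracleMeasure, L ∈ PRel (Oracle.ofLanguage A)) ∨
      (∀ᵐ (A : Set (List Bool)) ∂randomOracleMeasure, L ∉ PRel (Oracle.ofLanguage A)) := by
  rcases measure_setOf_mem_PRel_zero_or_one L with h | h
  · right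
    rw [ae_iff]
    simpa only [not_not] using h
  · left
    rw [ae_iff, ← Set.compl_setOf, prob_compl_eq_zero_iff (measurableSet_setOf_mem_PRel L)]
    exact h

/-- The ALMOST-P reading of the dichotomy: `L ∉ ALMOST-P` iff `L ∉ P^A` for almost every `A`.
[cite: BennettGill1981, Lemma 1 (zero-one law)] -/
theorem not_mem_almostP_iff_ae_not_mem (L : Language Bool) :
    L ∉ almostP ↔ ∀ᵐ (A : Set (List Bool)) ∂randomOracleMeasure, L ∉ PRel (Oracle.ofLanguage A) := by
  constructor
  · intro hL
    exact (ae_mem_PRel_or_ae_not_mem L).resolve_left fun h => hL (mem_almostP_iff.2 h)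
  · intro hae hL
    obtain ⟨A, hA, hA'⟩ := ((mem_almostP_iff.1 hL).and hae).exists
    exact hA' hA

end Literature.Computability.QuantumComplexity
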